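import Literature.NumberTheory.EllipticCurves.IsogenyDualProofs
import HarnessLib

/-!
# Orientation of a prime-degree isogeny on a rank-one Mordell–Weil line, and the degeneration of
# the Kummer extension of a Heegner-type point along it

Cell `bsd-litref`, tranche T3 (lw16), engineer seat `bsd-litref-lw16-eng` (g2). Pure algebra plus
one Galois-module lemma, serving the reading of Gross, *Kolyvagin's work on modular elliptic curves*
(LMS LN 153, 1991) §2 and Prop. 9.3 at a prime `p` where `E[p]` is REDUCIBLE: referee-reader 1's
structural lemma (`run/shared/lean/pub/bsd-litref/lw16/sheets/D-AUDIT-lw16-r1.md` §2.3 (i), §7 (c);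
reader 2 concordant, `CONCORDANCE-lw16-r1-r2.md`), typed here so that the theorem-grade footnote of
the flag `LW16-Thm14-disputed-MN19-0.11` (typed GAP targets `GJPST2009Thm37`,
`KolyvaginCertificateReducible` of `KolyvaginReducibleTargets.lean`, p459666) rests on kernel
theorems and not on prose, and so that the per-class ORIENTATION diagnostic of the engine seat
(`lw16/eng/orient/`) has a precise meaning. Summits-side (our own lemmas, not a published statement);
no `Theses` import.

## Contents (nothing here is specific to Heegner points; all statements are elementary)

* Vocabulary (kept INLINE in the statements, no new `def`): "`f ≡ 0 (mod p)` up to torsion" is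
  `∀ a, ∃ b, IsOfFinAddOrder (f a - p • b)` (every `f a` lies in `p·B + B_tors`; for groups that are
  `ℤ·(generator) + torsion` it says `f ⊗ ℤ_p = p·(something)` on the rank-one `ℤ_p`-line); "rank
  one with generator `x` modulo torsion" is the pair `¬ IsOfFinAddOrder x`,
  `∀ a, ∃ n : ℤ, IsOfFinAddOrder (a - n • x)` (`A = ℤx + A_tors`, `x ∉ A_tors`).
* `xor_divisible_mod_torsion_of_comp_eq_prime_smul` — **orientation dichotomy**: if `g ∘ f = p` on
  `A` with `p` prime and `A`, `B` both of rank one in the above sense, then EXACTLY ONE of `f`, `g`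
  is `≡ 0 (mod p)` up to torsion. (For a `p`-isogeny `φ : E → E'` over a number field `K` with
  `E(K)`, `E'(K)` of rank one, `f = φ` and `g = φ̂` on `K`-points: exactly one of `φ_*`, `φ̂_*` is an
  isomorphism on `E(K) ⊗ ℤ_p`; "Case A" of the reader's sheet is "`φ ≡ 0 (mod p)` up to torsion
  on `E(K)`", i.e. `p ∣ [E'(K) ⊗ ℤ_p : φ(E(K)) ⊗ ℤ_p]`, i.e. the `p`-isogenous curve fails the Heegner-index
  certificate that `E` passes.)
* `Isogeny.exists_root_smul_sub_mem_ker` / `Isogeny.smul_sub_mem_ker_of_root` (this namespace) — **Kummer degeneration in Case A**: for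
  isogenies `φ : E → E'`, `ψ : E' → E` of elliptic curves over `K` with `ψ ∘ φ = [n]`, if a
  geometric point `y` is of the form `ψ y' + n·z` with `y'`, `z` fixed by `Γ_K` (e.g. `K`-rational),
  then `y` has an `n`-th root `Q` with `σQ − Q ∈ ker φ` for EVERY `σ ∈ Γ_K`, and consequently every
  `n`-th root `Q'` of `y` has `σQ' − Q' ∈ ker φ` for every `σ` fixing `E[n]` pointwise. So the
  Kummer image of `Gal(K̄/K(E[n]))` attached to `y` lies in the LINE `ker φ`, not in all of `E[n]`:
  the conclusion "`Gal(L(y/p)/L) ≅ E[p]`" of Gross 1991 Prop. 9.3 (for `S = ⟨δ y⟩`) fails for such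
  `y` — which, by the dichotomy, is the situation of the Heegner point on one end of every rational
  `p`-isogeny between rank-one curves (`y_K ∈ φ̂(E'(K)) + pE(K)` is Case A read on `E`).

## References

* B. H. Gross, *Kolyvagin's work on modular elliptic curves*, in: L-functions and Arithmetic
  (Durham 1989), LMS Lecture Note Ser. 153 (1991), §2 (the Kummer map `δ`) and Prop. 9.3.
* J. H. Silverman, *The Arithmetic of Elliptic Curves*, GTM 106, III.6.1 (dual isogeny),
  VIII.§1 (Kummer pairing), X.4 Remark 4.7 (`#E'/φE · #E/φ̂E'` versus `#E/mE`). [SilvermanAEC2009]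
* A. Matar, J. Nekovář, JTNB 31 (2019) §0.10–0.11, Prop. 6.4 ((C5)/(C6) enter Gross's Props. 9.3,
  9.5); cell sheet `run/shared/lean/pub/bsd-litref/lw16/sheets/D-AUDIT-lw16-r1.md` §2.3.

HONEST FRAMING: elementary lemmas; they move no census class and assert nothing about BSD. They make
precise, as theorems, WHY the printed Kolyvagin–Gross argument needs more than `H¹ = H² = 0` at a
reducible prime (the reader's GAP(line)), and what the orientation diagnostic of the cell's engine
seat computes per class.
-/

namespace Summit.BirchSwinnertonDyer.Rank1Residual.LW16

section Algebra

variable {A B : Type*} [AddCommGroup A] [AddCommGroup B]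

/-- If `x` has infinite order and `n • x` has finite order then `n = 0`. [folklore] -/
theorem eq_zero_of_isOfFinAddOrder_zsmul {x : A} (hx : ¬ IsOfFinAddOrder x) {n : ℤ}
    (hn : IsOfFinAddOrder (n • x)) : n = 0 := by
  by_contra h
  obtain ⟨m, hm0, hm⟩ := (isOfFinAddOrder_iff_zsmul_eq_zero).mp hn
  exact hx ((isOfFinAddOrder_iff_zsmul_eq_zero).mpr ⟨m * n, mul_ne_zero hm0 h, by rw [mul_zsmul, hm]⟩)

/-- Coefficients modulo torsion along an element of infinite order are unique:
if `a − n•x` and `a − m•x` both have finite order then `n = m`. [folklore] -/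
theorem zsmul_coeff_unique {x : A} (hx : ¬ IsOfFinAddOrder x) {a : A} {n m : ℤ}
    (hn : IsOfFinAddOrder (a - n • x)) (hm : IsOfFinAddOrder (a - m • x)) : n = m := by
  have h : IsOfFinAddOrder ((m - n) • x) := by
    have : (m - n) • x = (a - n • x) - (a - m • x) := by module
    rw [this]
    rw [sub_eq_add_neg]
    exact hn.add hm.neg
  have := eq_zero_of_isOfFinAddOrder_zsmul hx h
  omega

/-- For `B = ℤy + B_tors` (`y` of infinite order), `A = ℤx + A_tors` and `f x ≡ a•y` modulo
torsion: every `f a'` lies in `p·B + B_tors` iff `p ∣ a`. [folklore] -/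
theorem forall_exists_isOfFinAddOrder_sub_smul_iff_dvd_coeff (f : A →+ B) (p : ℕ) {x : A}
    (hxA : ∀ a : A, ∃ n : ℤ, IsOfFinAddOrder (a - n • x)) {y : B} (hy0 : ¬ IsOfFinAddOrder y)
    (hyB : ∀ b : B, ∃ n : ℤ, IsOfFinAddOrder (b - n • y)) {a : ℤ}
    (ha : IsOfFinAddOrder (f x - a • y)) :
    (∀ a' : A, ∃ b : B, IsOfFinAddOrder (f a' - (p : ℤ) • b)) ↔ (p : ℤ) ∣ a := by
  constructor
  · rintro hfp
    obtain ⟨c, hc⟩ := hfp x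
    obtain ⟨m, hm⟩ := hyB c
    have h1 : IsOfFinAddOrder (f x - ((p : ℤ) * m) • y) := by
      have : f x - ((p : ℤ) * m) • y = (f x - (p : ℤ) • c) + (p : ℤ) • (c - m • y) := by module
      rw [this]; exact hc.add hm.zsmul
    exact ⟨m, zsmul_coeff_unique hy0 ha h1⟩
  · rintro ⟨c, rfl⟩ a'
    obtain ⟨n, hn⟩ := hxA a'
    refine ⟨(n * c) • y, ?_⟩
    have hfx : f (a' - n • x) = f a' - n • f x := by rw [map_sub, map_zsmul]
    have : f a' - (p : ℤ) • (n * c) • y = f (a' - n • x) + n • (f x - ((p : ℤ) * c) • y) := by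
      rw [hfx]; module
    rw [this]
    exact (f.isOfFinAddOrder hn).add ha.zsmul

/-- **Orientation dichotomy.** `f : A → B`, `g : B → A` with `g ∘ f = p` (`p` prime), `A` and `B`
both `ℤ·(generator) + torsion`: then exactly one of `f`, `g` is `≡ 0 (mod p)` up to torsion.
Proof: modulo torsion `f` is multiplication by an integer `a` and `g` by `b` with `ab = p`.
Applied to a rational `p`-isogeny `φ : E → E'` of elliptic curves over a number field with
`E(K)`, `E'(K)` of rank one (`f = φ`, `g = φ̂` on `K`-points, `φ̂φ = [p]`): exactly one of
`φ_*`, `φ̂_*` is an isomorphism of the rank-one lines `E(K) ⊗ ℤ_p → E'(K) ⊗ ℤ_p`; along the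
isogeny the index of a point of infinite order changes by the factor `p^{±1}` accordingly
(Silverman, *AEC*, X.4 Rem. 4.7; Gross 1991 §2). [folklore] -/
theorem xor_divisible_mod_torsion_of_comp_eq_prime_smul (f : A →+ B) (g : B →+ A) {p : ℕ}
    (hp : p.Prime) (hgf : ∀ a, g (f a) = (p : ℤ) • a) {x : A} (hx0 : ¬ IsOfFinAddOrder x)
    (hxA : ∀ a : A, ∃ n : ℤ, IsOfFinAddOrder (a - n • x)) {y : B} (hy0 : ¬ IsOfFinAddOrder y)
    (hyB : ∀ b : B, ∃ n : ℤ, IsOfFinAddOrder (b - n • y)) :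
    Xor (∀ a : A, ∃ b : B, IsOfFinAddOrder (f a - (p : ℤ) • b))
      (∀ b : B, ∃ a : A, IsOfFinAddOrder (g b - (p : ℤ) • a)) := by
  -- `f x = a • y + torsion`, `g y = b • x + torsion`
  obtain ⟨a, ha⟩ := hyB (f x)
  obtain ⟨b, hb⟩ := hxA (g y)
  -- `g (f x) = (a * b) • x + torsion`, hence `a * b = p`
  have hab : a * b = p := by
    have h1 : IsOfFinAddOrder (g (f x) - a • g y) := by
      have : g (f x) - a • g y = g (f x - a • y) := by rw [map_sub, map_zsmul]
      rw [this]; exact g.isOfFinAddOrder ha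
    have h2 : IsOfFinAddOrder (a • g y - (a * b) • x) := by
      have : a • g y - (a * b) • x = a • (g y - b • x) := by module
      rw [this]; exact hb.zsmul
    have h3 : IsOfFinAddOrder ((p : ℤ) • x - (a * b) • x) := by
      have : (p : ℤ) • x - (a * b) • x = (g (f x) - a • g y) + (a • g y - (a * b) • x) := by
        rw [hgf]; abel
      rw [this]; exact h1.add h2
    exact zsmul_coeff_unique hx0 (a := (p : ℤ) • x) h3 (by rw [sub_self]; exact IsOfFinAddOrder.zero)
  rw [forall_exists_isOfFinAddOrder_sub_smul_iff_dvd_coeff f p hxA hy0 hyB ha,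
    forall_exists_isOfFinAddOrder_sub_smul_iff_dvd_coeff g p hyB hx0 hxA hb]
  have hpz : Prime (p : ℤ) := Nat.prime_iff_prime_int.mp hp
  have key : ¬ ((p : ℤ) ∣ a ∧ (p : ℤ) ∣ b) := fun ⟨hpa, hpb⟩ ↦ by
    have h : (p : ℤ) * p ∣ a * b := mul_dvd_mul hpa hpb
    rw [hab] at h
    have hp0 : (p : ℤ) ≠ 0 := by exact_mod_cast hp.ne_zero
    have h1 : (p : ℤ) * p ∣ (p : ℤ) * 1 := by rw [mul_one]; exact h
    have h' : (p : ℤ) ∣ 1 := (mul_dvd_mul_iff_left hp0).mp h1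
    exact hpz.not_unit (isUnit_of_dvd_one h')
  rcases hpz.dvd_or_dvd (dvd_of_eq hab.symm) with hpa | hpb
  · exact Or.inl ⟨hpa, fun hpb ↦ key ⟨hpa, hpb⟩⟩
  · exact Or.inr ⟨hpb, fun hpa ↦ key ⟨hpa, hpb⟩⟩

/-- In a commutative group without `p`-torsion (`p` prime) every element of finite order is `p`
times an element: `t = p • (u • t)` with `u p ≡ 1 (mod ord t)`. [folklore] -/
theorem exists_eq_prime_zsmul_of_isOfFinAddOrder {p : ℕ} (hp : p.Prime)
    (hA : ∀ t : A, (p : ℤ) • t = 0 → t = 0) {t : A} (ht : IsOfFinAddOrder t) :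
    ∃ z : A, t = (p : ℤ) • z := by
  have hm : 0 < addOrderOf t := ht.addOrderOf_pos
  have hmt : (addOrderOf t : ℤ) • t = 0 := by rw [natCast_zsmul]; exact addOrderOf_nsmul_eq_zero t
  have hcop : Nat.Coprime p (addOrderOf t) := by
    rw [Nat.Prime.coprime_iff_not_dvd hp]
    rintro ⟨k, hk⟩
    have hkt : (k : ℤ) • t = 0 := by
      refine hA _ ?_
      rw [← mul_zsmul, ← Nat.cast_mul, ← hk]; exact hmt
    have hdk : addOrderOf t ∣ k := by
      have h := addOrderOf_dvd_iff_zsmul_eq_zero.mpr hkt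
      exact_mod_cast h
    have hk0 : 0 < k := Nat.pos_of_ne_zero (by rintro rfl; rw [mul_zero] at hk; omega)
    have h1 := Nat.le_of_dvd hk0 hdk
    have h2 := hp.two_le
    nlinarith
  obtain ⟨u, v, huv⟩ : IsCoprime (p : ℤ) (addOrderOf t : ℤ) := Nat.isCoprime_iff_coprime.mpr hcop
  refine ⟨u • t, ?_⟩
  calc t = (1 : ℤ) • t := (one_zsmul t).symm
    _ = (u * p + v * addOrderOf t) • t := by rw [huv]
    _ = (p : ℤ) • u • t + v • ((addOrderOf t : ℤ) • t) := by module
    _ = (p : ℤ) • u • t := by rw [hmt, zsmul_zero, add_zero]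

/-- **Case A read on `E`**: if `g : B → A` is NOT `≡ 0 (mod p)` up to torsion, `A`, `B` are
`ℤ·(generator) + torsion`, and `A` has no `p`-torsion, then `A = g(B) + pA`: every `a ∈ A` is
`g b + p • z`. With `A = E(K)`, `B = E'(K)`, `g = φ̂` and `a = y_K` this is the form
`y_K = φ̂(y') + p z` of the Heegner point that `Isogeny.exists_root_smul_sub_mem_ker` (below)
turns into the degeneration of its Kummer extension; by `xor_divisible_mod_torsion_of_comp_eq_prime_smul`
it happens on exactly one end of every rational `p`-isogeny between rank-one curves.
Silverman, *AEC*, X.4 Rem. 4.7; Gross 1991 §2. [folklore] -/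
theorem exists_eq_map_add_prime_zsmul_of_not_divisible_mod_torsion (g : B →+ A) {p : ℕ}
    (hp : p.Prime) {x : A} (hx0 : ¬ IsOfFinAddOrder x)
    (hxA : ∀ a : A, ∃ n : ℤ, IsOfFinAddOrder (a - n • x)) {y : B}
    (hyB : ∀ b : B, ∃ n : ℤ, IsOfFinAddOrder (b - n • y))
    (hA : ∀ t : A, (p : ℤ) • t = 0 → t = 0)
    (hg : ¬ ∀ b : B, ∃ a : A, IsOfFinAddOrder (g b - (p : ℤ) • a)) (a : A) :
    ∃ b : B, ∃ z : A, a = g b + (p : ℤ) • z := by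
  obtain ⟨b₀, hb⟩ := hxA (g y)
  have hndvd : ¬ (p : ℤ) ∣ b₀ := fun h ↦
    hg ((forall_exists_isOfFinAddOrder_sub_smul_iff_dvd_coeff g p hyB hx0 hxA hb).mpr h)
  have hpz : Prime (p : ℤ) := Nat.prime_iff_prime_int.mp hp
  obtain ⟨u, v, huv⟩ : IsCoprime (p : ℤ) b₀ := (Prime.coprime_iff_not_dvd hpz).mpr hndvd
  obtain ⟨n, hn⟩ := hxA a
  -- `a = n • x + t₁`, `x = (u p + v b₀) • x = p • (u • x) + v • (g y - t₀)`
  set t₀ := g y - b₀ • x with ht₀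
  set t₁ := a - n • x with ht₁
  obtain ⟨z₀, hz₀⟩ := exists_eq_prime_zsmul_of_isOfFinAddOrder hp hA hb
  obtain ⟨z₁, hz₁⟩ := exists_eq_prime_zsmul_of_isOfFinAddOrder hp hA hn
  refine ⟨(n * v) • y, (n * u) • x - (n * v) • z₀ + z₁, ?_⟩
  have hgy : g y = b₀ • x + (p : ℤ) • z₀ := by rw [← hz₀, ht₀]; abel
  have ha : a = n • x + t₁ := by rw [ht₁]; abel
  have hn' : n • x = (n * (u * p + v * b₀)) • x := by rw [huv, mul_one]
  rw [map_zsmul, ha, hz₁, hgy, hn']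
  module

end Algebra

/-! ## The Kummer degeneration along an isogeny (Gross 1991 §2 / Prop. 9.3, reducible case) -/

section Kummer

open WeierstrassCurve

universe u

variable {K : Type u} [Field K] {W W' : WeierstrassCurve K} [W.IsElliptic] [W'.IsElliptic]

/-- **Kummer degeneration in Case A.** Let `φ : E → E'`, `ψ : E' → E` be isogenies of elliptic
curves over `K` with `ψ ∘ φ = [n]`, and let `y = ψ y' + n • z` with `y'`, `z` fixed by `Γ_K`. Then
`y` has an `n`-th root `Q` in `E(K̄)` with `σQ − Q ∈ ker φ` for every `σ ∈ Γ_K` (take `Q = Q₀ + z`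
with `φ Q₀ = y'`, which exists as `φ` is onto `E'(K̄)`; then `φ(σQ₀ − Q₀) = σy' − y' = 0`).
Gross 1991 §2 (Kummer map); Silverman, *AEC*, VIII.§1. [folklore] -/
theorem Isogeny.exists_root_smul_sub_mem_ker (φ : Isogeny W W') (ψ : Isogeny W' W) {n : ℤ}
    (hψφ : ∀ P, ψ (φ P) = n • P) {y z : W.geomPoints} {y' : W'.geomPoints}
    (hy' : ∀ σ : Field.absoluteGaloisGroup K, σ • y' = y')
    (hz : ∀ σ : Field.absoluteGaloisGroup K, σ • z = z) (hy : y = ψ y' + n • z) :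
    ∃ Q : W.geomPoints, n • Q = y ∧
      ∀ σ : Field.absoluteGaloisGroup K, σ • Q - Q ∈ φ.toAddMonoidHom.ker := by
  obtain ⟨Q₀, hQ₀⟩ := φ.surjective y'
  refine ⟨Q₀ + z, ?_, fun σ ↦ ?_⟩
  · rw [smul_add, ← hψφ Q₀, hQ₀, hy]
  · rw [smul_add, hz, AddMonoidHom.mem_ker]
    have : σ • Q₀ + z - (Q₀ + z) = σ • Q₀ - Q₀ := by abel
    rw [this, map_sub, Isogeny.coe_toAddMonoidHom, φ.map_smul, hQ₀, hy', sub_self]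

/-- **Every `n`-th root, for `σ` fixing `E[n]`.** In the situation of
`exists_root_smul_sub_mem_ker`, for ANY `Q` with `n • Q = y` and any `σ ∈ Γ_K` fixing the
`n`-torsion of `E(K̄)` pointwise, `σQ − Q ∈ ker φ`. Hence the Kummer image of `Gal(K̄/K(E[n]))`
attached to `y` lies in the line `ker φ`: for `n = p = deg φ` and `y = y_K ∈ ψ(E'(K)) + pE(K)`
("Case A"), `Gal(L(y_K/p)/L) ↪ ker φ ≠ E[p]` — the conclusion of Gross 1991 Prop. 9.3 fails,
which is where the printed argument uses the irreducibility of `E[p]` (Matar–Nekovář 2019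
Prop. 6.4 (C5)). Gross 1991 §2, Prop. 9.3; Silverman, *AEC*, VIII.§1. [folklore] -/
theorem Isogeny.smul_sub_mem_ker_of_root (φ : Isogeny W W') (ψ : Isogeny W' W) {n : ℤ}
    (hψφ : ∀ P, ψ (φ P) = n • P) {y z : W.geomPoints} {y' : W'.geomPoints}
    (hy' : ∀ σ : Field.absoluteGaloisGroup K, σ • y' = y')
    (hz : ∀ σ : Field.absoluteGaloisGroup K, σ • z = z) (hy : y = ψ y' + n • z)
    {Q : W.geomPoints} (hQ : n • Q = y) {σ : Field.absoluteGaloisGroup K}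
    (hσ : ∀ T : W.geomPoints, n • T = 0 → σ • T = T) :
    σ • Q - Q ∈ φ.toAddMonoidHom.ker := by
  obtain ⟨Q₁, hQ₁, hker⟩ := Isogeny.exists_root_smul_sub_mem_ker φ ψ hψφ hy' hz hy
  have hT : σ • (Q - Q₁) = Q - Q₁ := hσ _ (by rw [smul_sub, hQ, hQ₁, sub_self])
  rw [smul_sub] at hT
  have : σ • Q - Q = σ • Q₁ - Q₁ := by rw [sub_eq_sub_iff_sub_eq_sub]; exact hT
  rw [this]
  exact hker σ

end Kummer

end Summit.BirchSwinnertonDyer.Rank1Residual.LW16
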